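import Summits.AtomisticToContinuum.Crystallization.Theorems.FrustratedLawDichotomyCellArithNash

/-!
# FrustratedLawDichotomy · crux `AperiodicFrustratedLawGap` (stmt-AtomisticToContinuum-27623) — CELL-ARITH, SHARED CLASS READINGS for the
# per-label columns (decomp-a2c hand-1 g53; critic r1785 (A)/(B): the per-label NASH block ≈ 19 k leaves and the remainder pairs ≈ 21–23 k
# leaves dominate the ≈ 290 s/cell kernel projection — but their `ψ`/`ψ′`/`forceRem` readings depend on the BOND CLASS only)

The primed editions below take the four window readings `PL ≤ S·ψ(t) ≤ PH`, `P1L ≤ S·ψ′(t) ≤ P1H` (and `S·forceRem ≤ FR`) as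
INTEGER ARGUMENTS with reading hypotheses instead of recomputing `psiLoZ/psiHiZ/psi1LoZ/psi1HiZ/forceRemHiZ` inside every term:
a K-file evaluates those once per bond class `|Δz|²` (142 classes for fcc, 899 for F1 — `…CellArithLJ.psiLoZ_le` etc. give the
hypotheses) and the per-label / per-pair work is only `⌊⌋/⌈⌉` of small rational multiples (`smulCoord`, `corner`), an order of
magnitude fewer kernel steps per leaf.

* §1 `linLabLoZ'/linLabHiZ'` + `linLabLoZ'_le/le_linLabHiZ'` (coordinates of (252) `linLab` from shared readings);
* §2 `nashLoZ'/nashHiZ'` + `nash_mem'` (the (252) `nashVecLab` box from per-pair reading TABLES `PL PH P1L P1H : ι → ℤ`);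
* §3 `rmTerm_le'` (one `hRM` summand from a shared `forceRem` reading `FR`), `pairing_le_cornerHi'` is `…CellArithTaylor.le_cornerHi` itself.

Computable `def`s (4) + soundness; imports `…CellArithNash`; 0 sorry.  Tags: [folklore].
-/

namespace Summit.AtomisticToContinuum.Crystallization.Theorems.FrustratedLawDichotomyCellArithShared

open scoped BigOperators
open Summit.AtomisticToContinuum.Crystallization.Theorems.FrustratedLawDichotomyCoherentFloorAlgebra (psiT psiT1 forceRem)
open Summit.AtomisticToContinuum.Crystallization.Theorems.FrustratedLawDichotomyCellMetric (gram linLab nashVecLab)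
open Summit.AtomisticToContinuum.Crystallization.Theorems.FrustratedLawDichotomyCellArith
open Summit.AtomisticToContinuum.Crystallization.Theorems.FrustratedLawDichotomyCellArithTaylor (cornerLo cornerHi le_cornerHi cornerLo_le)
open Summit.AtomisticToContinuum.Crystallization.Theorems.FrustratedLawDichotomyCellArithGram
  (smulCoordLo smulCoordHi smulCoordLo_le le_smulCoordHi two_mul_mem finsetSum_readings_le le_finsetSum_readings)

variable {ι : Type*} [DecidableEq ι]

/-! ## §1 `linLab` coordinates from shared readings -/

/-- LOWER reading of `(linLab G z y) i` from SHARED readings `PL ≤ S·ψ(g z z) ≤ PH`, `P1L ≤ S·ψ′(g z z) ≤ P1H`. [folklore] -/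
def linLabLoZ' (PL PH P1L P1H : ℤ) (glo ghi yi zi : ℚ) : ℤ :=
  smulCoordLo PL PH yi + cornerLo P1L P1H (min (2 * glo * zi) (2 * ghi * zi)) (max (2 * glo * zi) (2 * ghi * zi))

/-- UPPER reading of `(linLab G z y) i` from shared readings. [folklore] -/
def linLabHiZ' (PL PH P1L P1H : ℤ) (glo ghi yi zi : ℚ) : ℤ :=
  smulCoordHi PL PH yi + cornerHi P1L P1H (min (2 * glo * zi) (2 * ghi * zi)) (max (2 * glo * zi) (2 * ghi * zi))

section LinLab

variable {S PL PH P1L P1H : ℤ} {G : Matrix (Fin 3) (Fin 3) ℝ} {z y : Fin 3 → ℝ} {glo ghi : ℚ} {yq zq : Fin 3 → ℚ} {i : Fin 3}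

omit [DecidableEq ι] in
/-- ★ `linLabLoZ' ≤ S·(linLab G z y) i`. [folklore] -/
theorem linLabLoZ'_le (hPL : (PL : ℝ) ≤ S * psiT (gram G z z)) (hPH : S * psiT (gram G z z) ≤ (PH : ℝ))
    (hP1L : (P1L : ℝ) ≤ S * psiT1 (gram G z z)) (hP1H : S * psiT1 (gram G z z) ≤ (P1H : ℝ))
    (hg1 : (glo : ℝ) ≤ gram G z y) (hg2 : gram G z y ≤ (ghi : ℝ)) (hy : y i = (yq i : ℝ)) (hz : z i = (zq i : ℝ)) :
    ((linLabLoZ' PL PH P1L P1H glo ghi (yq i) (zq i) : ℤ) : ℝ) ≤ S * linLab G z y i := by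
  have A := smulCoordLo_le (c := yq i) hPL hPH
  obtain ⟨m1, m2⟩ := two_mul_mem (i := i) hg1 hg2 hz
  have B := cornerLo_le hP1L hP1H m1 m2
  unfold linLabLoZ'
  have e : S * linLab G z y i = S * (psiT (gram G z z) * (yq i : ℝ)) + S * (psiT1 (gram G z z) * (2 * gram G z y * z i)) := by
    simp only [linLab, Pi.add_apply, Pi.smul_apply, smul_eq_mul, hy]; ring
  rw [e]; push_cast; exact add_le_add A B

omit [DecidableEq ι] in
/-- ★ `S·(linLab G z y) i ≤ linLabHiZ'`. [folklore] -/
theorem le_linLabHiZ' (hPL : (PL : ℝ) ≤ S * psiT (gram G z z)) (hPH : S * psiT (gram G z z) ≤ (PH : ℝ))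
    (hP1L : (P1L : ℝ) ≤ S * psiT1 (gram G z z)) (hP1H : S * psiT1 (gram G z z) ≤ (P1H : ℝ))
    (hg1 : (glo : ℝ) ≤ gram G z y) (hg2 : gram G z y ≤ (ghi : ℝ)) (hy : y i = (yq i : ℝ)) (hz : z i = (zq i : ℝ)) :
    S * linLab G z y i ≤ ((linLabHiZ' PL PH P1L P1H glo ghi (yq i) (zq i) : ℤ) : ℝ) := by
  have A := le_smulCoordHi (c := yq i) hPL hPH
  obtain ⟨m1, m2⟩ := two_mul_mem (i := i) hg1 hg2 hz
  have B := le_cornerHi hP1L hP1H m1 m2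
  unfold linLabHiZ'
  have e : S * linLab G z y i = S * (psiT (gram G z z) * (yq i : ℝ)) + S * (psiT1 (gram G z z) * (2 * gram G z y * z i)) := by
    simp only [linLab, Pi.add_apply, Pi.smul_apply, smul_eq_mul, hy]; ring
  rw [e]; push_cast; exact add_le_add A B

end LinLab

/-! ## §2 The NASH box from per-pair reading tables -/

/-- LOWER reading of coordinate `i` of `nashVecLab G M MI a ω nb m` from reading TABLES: `P0L/P0H` for `ψ(g(a m,a m))`; for own-multiplier
pairs `m'`: `PL PH P1L P1H m'` (readings of `ψ`, `ψ′` at `g(z,z)`, `z = a m − a m'`) and `glo ghi m'` (interval of `g(z, ω m)`); for neighbour pairs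
`x`: primed tables at `z = a x − a m` with `glo' ghi' x` for `g(z, ω x)`. [folklore] -/
def nashLoZ' (M MI : Finset ι) (nb : ι → Finset ι) (m : ι) (i : Fin 3) (aq ωq : ι → Fin 3 → ℚ) (P0L P0H : ℤ)
    (PL PH P1L P1H : ι → ℤ) (glo ghi : ι → ℚ) (PL' PH' P1L' P1H' : ι → ℤ) (glo' ghi' : ι → ℚ) : ℤ :=
  smulCoordLo P0L P0H (aq m i)
    - (if m ∈ MI then ∑ m' ∈ (M.erase m).filter (fun m' => m' ∈ nb m),
        linLabHiZ' (PL m') (PH m') (P1L m') (P1H m') (glo m') (ghi m') (ωq m i) (aq m i - aq m' i) else 0)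
    + ∑ x ∈ (MI.erase m).filter (fun x => x ∈ nb m),
        linLabLoZ' (PL' x) (PH' x) (P1L' x) (P1H' x) (glo' x) (ghi' x) (ωq x i) (aq x i - aq m i)

/-- UPPER reading of coordinate `i` of `nashVecLab G M MI a ω nb m` from reading tables. [folklore] -/
def nashHiZ' (M MI : Finset ι) (nb : ι → Finset ι) (m : ι) (i : Fin 3) (aq ωq : ι → Fin 3 → ℚ) (P0L P0H : ℤ)
    (PL PH P1L P1H : ι → ℤ) (glo ghi : ι → ℚ) (PL' PH' P1L' P1H' : ι → ℤ) (glo' ghi' : ι → ℚ) : ℤ :=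
  smulCoordHi P0L P0H (aq m i)
    - (if m ∈ MI then ∑ m' ∈ (M.erase m).filter (fun m' => m' ∈ nb m),
        linLabLoZ' (PL m') (PH m') (P1L m') (P1H m') (glo m') (ghi m') (ωq m i) (aq m i - aq m' i) else 0)
    + ∑ x ∈ (MI.erase m).filter (fun x => x ∈ nb m),
        linLabHiZ' (PL' x) (PH' x) (P1L' x) (P1H' x) (glo' x) (ghi' x) (ωq x i) (aq x i - aq m i)

section Nash

variable {S : ℤ} {G : Matrix (Fin 3) (Fin 3) ℝ} {M MI : Finset ι} {nb : ι → Finset ι} {m : ι} {i : Fin 3}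
  {a ω : ι → Fin 3 → ℝ} {aq ωq : ι → Fin 3 → ℚ} {P0L P0H : ℤ} {PL PH P1L P1H PL' PH' P1L' P1H' : ι → ℤ}
  {glo ghi glo' ghi' : ι → ℚ}

/-- ★ THE NASH BOX from shared readings: `nashLoZ' ≤ S·(nashVecLab …) i ≤ nashHiZ'`. [folklore] -/
theorem nash_mem' (ha : ∀ x j, a x j = (aq x j : ℝ)) (hω : ∀ x j, ω x j = (ωq x j : ℝ))
    (h0L : (P0L : ℝ) ≤ S * psiT (gram G (a m) (a m))) (h0H : S * psiT (gram G (a m) (a m)) ≤ (P0H : ℝ))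
    (hown : ∀ m' ∈ (M.erase m).filter (fun m' => m' ∈ nb m),
      (PL m' : ℝ) ≤ S * psiT (gram G (a m - a m') (a m - a m')) ∧ S * psiT (gram G (a m - a m') (a m - a m')) ≤ (PH m' : ℝ)
        ∧ (P1L m' : ℝ) ≤ S * psiT1 (gram G (a m - a m') (a m - a m')) ∧ S * psiT1 (gram G (a m - a m') (a m - a m')) ≤ (P1H m' : ℝ)
        ∧ (glo m' : ℝ) ≤ gram G (a m - a m') (ω m) ∧ gram G (a m - a m') (ω m) ≤ (ghi m' : ℝ))
    (hnbr : ∀ x ∈ (MI.erase m).filter (fun x => x ∈ nb m),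
      (PL' x : ℝ) ≤ S * psiT (gram G (a x - a m) (a x - a m)) ∧ S * psiT (gram G (a x - a m) (a x - a m)) ≤ (PH' x : ℝ)
        ∧ (P1L' x : ℝ) ≤ S * psiT1 (gram G (a x - a m) (a x - a m)) ∧ S * psiT1 (gram G (a x - a m) (a x - a m)) ≤ (P1H' x : ℝ)
        ∧ (glo' x : ℝ) ≤ gram G (a x - a m) (ω x) ∧ gram G (a x - a m) (ω x) ≤ (ghi' x : ℝ)) :
    ((nashLoZ' M MI nb m i aq ωq P0L P0H PL PH P1L P1H glo ghi PL' PH' P1L' P1H' glo' ghi' : ℤ) : ℝ)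
        ≤ S * nashVecLab G M MI a ω nb m i
      ∧ S * nashVecLab G M MI a ω nb m i
        ≤ ((nashHiZ' M MI nb m i aq ωq P0L P0H PL PH P1L P1H glo ghi PL' PH' P1L' P1H' glo' ghi' : ℤ) : ℝ) := by
  have L1 := smulCoordLo_le (c := aq m i) h0L h0H
  have L2 := le_smulCoordHi (c := aq m i) h0L h0H
  have hsub : ∀ x y : ι, (a x - a y) i = ((aq x i - aq y i : ℚ) : ℝ) := by
    intro x y; simp only [Pi.sub_apply, ha]; push_cast; ring
  have A1 : ∀ m' ∈ (M.erase m).filter (fun m' => m' ∈ nb m),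
      ((linLabLoZ' (PL m') (PH m') (P1L m') (P1H m') (glo m') (ghi m') (ωq m i) (aq m i - aq m' i) : ℤ) : ℝ)
        ≤ S * linLab G (a m - a m') (ω m) i := by
    intro m' hm'
    obtain ⟨p1, p2, p3, p4, g1, g2⟩ := hown m' hm'
    exact linLabLoZ'_le (yq := ωq m) (zq := fun j => aq m j - aq m' j) p1 p2 p3 p4 g1 g2 (hω m i) (hsub m m')
  have A2 : ∀ m' ∈ (M.erase m).filter (fun m' => m' ∈ nb m),
      S * linLab G (a m - a m') (ω m) i
        ≤ ((linLabHiZ' (PL m') (PH m') (P1L m') (P1H m') (glo m') (ghi m') (ωq m i) (aq m i - aq m' i) : ℤ) : ℝ) := by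
    intro m' hm'
    obtain ⟨p1, p2, p3, p4, g1, g2⟩ := hown m' hm'
    exact le_linLabHiZ' (yq := ωq m) (zq := fun j => aq m j - aq m' j) p1 p2 p3 p4 g1 g2 (hω m i) (hsub m m')
  have B1 : ∀ x ∈ (MI.erase m).filter (fun x => x ∈ nb m),
      ((linLabLoZ' (PL' x) (PH' x) (P1L' x) (P1H' x) (glo' x) (ghi' x) (ωq x i) (aq x i - aq m i) : ℤ) : ℝ)
        ≤ S * linLab G (a x - a m) (ω x) i := by
    intro x hx
    obtain ⟨p1, p2, p3, p4, g1, g2⟩ := hnbr x hx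
    exact linLabLoZ'_le (yq := ωq x) (zq := fun j => aq x j - aq m j) p1 p2 p3 p4 g1 g2 (hω x i) (hsub x m)
  have B2 : ∀ x ∈ (MI.erase m).filter (fun x => x ∈ nb m),
      S * linLab G (a x - a m) (ω x) i
        ≤ ((linLabHiZ' (PL' x) (PH' x) (P1L' x) (P1H' x) (glo' x) (ghi' x) (ωq x i) (aq x i - aq m i) : ℤ) : ℝ) := by
    intro x hx
    obtain ⟨p1, p2, p3, p4, g1, g2⟩ := hnbr x hx
    exact le_linLabHiZ' (yq := ωq x) (zq := fun j => aq x j - aq m j) p1 p2 p3 p4 g1 g2 (hω x i) (hsub x m)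
  have SA1 := finsetSum_readings_le S _ _ _ A1
  have SA2 := le_finsetSum_readings S _ _ _ A2
  have SB1 := finsetSum_readings_le S _ _ _ B1
  have SB2 := le_finsetSum_readings S _ _ _ B2
  have e : nashVecLab G M MI a ω nb m i = (psiT (gram G (a m) (a m)) • a m) i
      - (if m ∈ MI then ∑ m' ∈ (M.erase m).filter (fun m' => m' ∈ nb m), linLab G (a m - a m') (ω m) i else 0)
      + ∑ x ∈ (MI.erase m).filter (fun x => x ∈ nb m), linLab G (a x - a m) (ω x) i := by
    unfold nashVecLab
    by_cases h : m ∈ MI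
    · simp [h, Finset.sum_apply]; ring
    · simp [h, Finset.sum_apply]
  have eL : (psiT (gram G (a m) (a m)) • a m) i = psiT (gram G (a m) (a m)) * (aq m i : ℝ) := by
    simp only [Pi.smul_apply, smul_eq_mul, ha]
  rw [e, eL]
  unfold nashLoZ' nashHiZ'
  by_cases hMI : m ∈ MI
  · simp only [hMI, if_true]
    push_cast at SA1 SA2 SB1 SB2 L1 L2 ⊢
    constructor <;> nlinarith [SA1, SA2, SB1, SB2, L1, L2]
  · simp only [hMI, if_false]
    push_cast at SB1 SB2 L1 L2 ⊢
    constructor <;> nlinarith [SB1, SB2, L1, L2]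

end Nash

/-! ## §3 The remainder pair term from a shared `forceRem` reading -/

omit [DecidableEq ι] in
/-- ★ one `hRM` summand with a SHARED class reading `S·forceRem r η ≤ FR` (from `…CellArithTaylor.le_forceRemHiZ`, once per bond class and
`η ∈ {τ, 2τ}`): `0 ≤ a ≤ yb ⇒ a·forceRem r η ≤ scHi yb FR / S`. [folklore] -/
theorem rmTerm_le' {S FR : ℤ} {a r η : ℝ} {yb : ℚ} (hS : 0 < S) (ha0 : 0 ≤ a) (ha : a ≤ (yb : ℝ)) (hf0 : 0 ≤ forceRem r η)
    (hFR : S * forceRem r η ≤ (FR : ℝ)) : a * forceRem r η ≤ ((scHi yb FR : ℤ) : ℝ) / S := by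
  refine le_div_of_reading hS ?_
  have hyb0 : 0 ≤ yb := by
    have : (0 : ℝ) ≤ yb := ha0.trans ha
    exact_mod_cast this
  have H := le_scHi (c := yb) hyb0 hFR
  have hy : S * (a * forceRem r η) ≤ S * ((yb : ℝ) * forceRem r η) :=
    mul_le_mul_of_nonneg_left (mul_le_mul_of_nonneg_right ha hf0) (by exact_mod_cast hS.le)
  exact hy.trans H

end Summit.AtomisticToContinuum.Crystallization.Theorems.FrustratedLawDichotomyCellArithShared
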